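import Summits.ValiantsHypothesis.ValiantsHypothesis.Theorems.KPlusLogSqLawTropicalGradedWalkDomXGlue1

/-!
# Dominance glue (type X), part 4: the lifted block column `b = u`

GRW-lite `K = 4` graded-walk family (census side of the tropical root law, all `m`):
dominance glue for the EXCURSION states `(w, u, 1)`, `2 ≤ u ≤ w − 1 < m − 1`, of the design typed in
`KPlusLogSqLawTropicalGradedWalkDefs` (Leibniz term: the diagonal term of `(w, u, 0)` with the rows of the columns
`u − 1`, `u` exchanged).  This part dispatches an arbitrary rival `(a, u, l)` of the LIFTED column `u`
(intended incidence: row `R₁ = m − w + u − 1`, class `1`, level `w + 1`) to its slack family of `…DomX3` / `…DomX4`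
(far rivals are first reduced to the best class of their level by the generic lifts of `…GradedWalkLift`).

Honest framing: this is a census-side (lower-bound) construction — a quadratic family of
distinct optimal slopes for `TropRootLawAt (n+1) 4`.  It says nothing about `TropicalB` inside
its window and nothing about VP ≠ VNP.
-/

set_option linter.dupNamespace false
set_option autoImplicit false

namespace Summit.ValiantsHypothesis.ValiantsHypothesis.Theorems.LacunarySymmetroidMatrixDescartes.TropicalCensus

namespace GradedWalk

open Summit.ValiantsHypothesis.ValiantsHypothesis.Theorems.MatrixDescartes.Negative

variable (n : ℕ)

/-! ### slack, the lifted column `b = u` -/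

set_option maxHeartbeats 400000 in
/-- slack of the type-X certificate: the lifted block column `b = u`, rival rows above the intended row `R₁`. -/
theorem slackX_u_hi (w u : ℕ) (hu2 : 2 ≤ u) (huw : u < w) (hwn : w ≤ n) (a b : Fin (n + 1)) (l : Fin 4)
    (hp : ee n a b l ≠ 0) (hbu : (b : ℕ) = u) (haR : (a : ℕ) < n + 1 - w + u - 1) :
    1 * (thX n w u * (dd n l : ℤ) - vv n a b l) <
      UX n w u a + ((thX n w u * (dd n (lam n w u 1 b) : ℤ) - vv n (perm n w u 1 b) b (lam n w u 1 b)) - UX n w u (perm n w u 1 b)) := by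
  have hw1 : w ≤ n + 1 := by omega
  have han : (a : ℕ) ≤ n := Nat.lt_succ_iff.mp a.isLt
  have hr : ((perm n w u 1 b : Fin (n + 1)) : ℕ) = n + 1 - w + u - 1 := sigmaX_u n huw hwn b hbu
  rw [lam_X n huw]
  rw [if_neg (show ¬ w ≤ (b : ℕ) by omega), if_neg (show ¬ ((b : ℕ) + 1 < u) by omega),
    if_neg (show ¬ ((b : ℕ) < u) by omega)]
  have hT1 : thX n w u * (dd n 1 : ℤ) - vv n (perm n w u 1 b) b 1 = thX n w u * d1 n - v1 n (w + 1) (u) := by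
    rcases Nat.lt_or_ge w n with hwn' | hwn'
    · have hlowr : (b : ℕ) < ((perm n w u 1 b : Fin (n + 1)) : ℕ) := by rw [hr]; omega
      rw [dd_cast_one, vv_lower n hlowr, hr, show n + 1 + (b : ℕ) - (n + 1 - w + u - 1) = w + 1 by omega, vblk_one, hbu]
    · have hdg : (((perm n w u 1 b : Fin (n + 1)) : ℕ)) = (b : ℕ) := by rw [hr]; omega
      rw [dd_cast_one, vv_diag n hdg 1 (by decide), vblk_one, hbu, show n + 1 = w + 1 by omega]
  have hUr : UX n w u ((perm n w u 1 b : Fin (n + 1)) : ℕ) = gG n * thX n w u * (((n + 1 - w + (u - 1)) : ℕ) : ℤ) + SXR1 n w u := by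
    rw [hr]; unfold UX; rw [show n + 1 - w + u - 1 - (n + 1 - w) = u - 1 by omega, muX_R1 n (show u - 1 + 1 = u by omega),
      show n + 1 - w + u - 1 = n + 1 - w + (u - 1) by omega]
  rcases Nat.lt_or_ge (a : ℕ) (b : ℕ) with hab | hba
  · -- wrap cells above the diagonal: classes 0 / 1
    have hl : l = 0 ∨ l = 1 := by
      rcases (show l = 0 ∨ l = 1 ∨ l = 2 ∨ l = 3 by fin_cases l <;> simp) with rfl | rfl | rfl | rfl
      · exact Or.inl rfl
      · exact Or.inr rfl
      · exact absurd (ee_upper_ge_two n hab 2 (by decide)) hp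
      · exact absurd (ee_upper_ge_two n hab 3 (by decide)) hp
    rcases hl with rfl | rfl
    · rcases Nat.eq_zero_or_pos (a : ℕ) with ha0 | ha0
      · have hc : (((((u)) - (0) : ℕ)) : ℤ) = (((b : ℕ)) : ℤ) - (((a : ℕ)) : ℤ) := by
          rw [hbu, ha0, Nat.sub_zero]; simp
        have hX : thX n w u * (dd n 0 : ℤ) - vv n a b 0 = ((0 : ℤ) - 4 * mZ n * gG n ^ 2 * ((((u) - (0)) : ℕ) : ℤ) ^ 2) := by
          rw [dd_cast_zero, vv_upper_zero n hab, hc]; ring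
        have hY : UX n w u a - UX n w u ((perm n w u 1 b : Fin (n + 1)) : ℕ) = ((0 : ℤ) - (gG n * thX n w u * (((n + 1 - w + (u - 1)) : ℕ) : ℤ) + SXR1 n w u)) := by
          rw [hUr]; unfold UX; rw [ha0, Nat.zero_sub, muX_zero n hu2]; simp
        exact slack_of (X_u_w0_R0 n w u hu2 (by omega) hwn) hX hT1 hY
      · rcases Nat.lt_or_ge (n + 1 - w) (a : ℕ) with hblk | hpl
        · obtain ⟨jp, hjp⟩ : ∃ jp, (a : ℕ) = (n + 1 - w) + jp := ⟨(a : ℕ) - (n + 1 - w), by omega⟩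
          have hc : (((((u)) - ((n + 1 - w) + jp) : ℕ)) : ℤ) = (((b : ℕ)) : ℤ) - (((a : ℕ)) : ℤ) := by
            rw [hbu, hjp]; push_cast [Nat.cast_sub (show (n + 1 - w) + jp ≤ u by omega)]; ring
          have hX : thX n w u * (dd n 0 : ℤ) - vv n a b 0 = ((0 : ℤ) - 4 * mZ n * gG n ^ 2 * (((((u)) - ((n + 1 - w) + jp)) : ℕ) : ℤ) ^ 2) := by
            rw [dd_cast_zero, vv_upper_zero n hab, hc]; ring
          have hY : UX n w u a - UX n w u ((perm n w u 1 b : Fin (n + 1)) : ℕ) = ((gG n * thX n w u * ((((n + 1 - w) + (jp)) : ℕ) : ℤ) + SX2 n w u (jp)) - (gG n * thX n w u * (((n + 1 - w + (u - 1)) : ℕ) : ℤ) + SXR1 n w u)) := by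
            rw [hUr]; unfold UX; rw [show (a : ℕ) - (n + 1 - w) = jp by omega, muX_lt n (by omega), hjp]
          exact slack_of (X_u_w0_B n w u jp ((n + 1 - w)) (by omega) (by omega) (by omega) (by omega) (by omega)) hX hT1 hY
        · have hc : (((((u)) - ((a : ℕ)) : ℕ)) : ℤ) = (((b : ℕ)) : ℤ) - (((a : ℕ)) : ℤ) := by
            rw [hbu]; push_cast [Nat.cast_sub (show (a : ℕ) ≤ u by omega)]; ring
          have hX : thX n w u * (dd n 0 : ℤ) - vv n a b 0 = ((0 : ℤ) - 4 * mZ n * gG n ^ 2 * (((((u)) - ((a : ℕ))) : ℕ) : ℤ) ^ 2) := by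
            rw [dd_cast_zero, vv_upper_zero n hab, hc]; ring
          have hY : UX n w u a - UX n w u ((perm n w u 1 b : Fin (n + 1)) : ℕ) = (gG n * thX n w u * (((a) : ℕ) : ℤ) - (gG n * thX n w u * (((n + 1 - w + (u - 1)) : ℕ) : ℤ) + SXR1 n w u)) := by
            rw [hUr]; unfold UX; rw [show (a : ℕ) - (n + 1 - w) = 0 by omega, muX_zero n hu2]; simp
          exact slack_of (X_u_w0_P n w u a (by omega) (by omega) (by omega) (by omega)) hX hT1 hY
    · rcases Nat.eq_zero_or_pos (a : ℕ) with ha0 | ha0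
      · have hX : thX n w u * (dd n 1 : ℤ) - vv n a b 1 = (thX n w u * d1 n - conn n (((u)) - (0)) ((u))) := by
          rw [dd_cast_one, vv_upper_one n hab, ha0, hbu]
        have hY : UX n w u a - UX n w u ((perm n w u 1 b : Fin (n + 1)) : ℕ) = ((0 : ℤ) - (gG n * thX n w u * (((n + 1 - w + (u - 1)) : ℕ) : ℤ) + SXR1 n w u)) := by
          rw [hUr]; unfold UX; rw [ha0, Nat.zero_sub, muX_zero n hu2]; simp
        exact slack_of (X_u_cn_R0 n w u hu2 (by omega) hwn) hX hT1 hY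
      · rcases Nat.lt_or_ge (n + 1 - w) (a : ℕ) with hblk | hpl
        · obtain ⟨jp, hjp⟩ : ∃ jp, (a : ℕ) = (n + 1 - w) + jp := ⟨(a : ℕ) - (n + 1 - w), by omega⟩
          have hX : thX n w u * (dd n 1 : ℤ) - vv n a b 1 = (thX n w u * d1 n - conn n (((u)) - ((n + 1 - w) + jp)) ((u))) := by
            rw [dd_cast_one, vv_upper_one n hab, hjp, hbu]
          have hY : UX n w u a - UX n w u ((perm n w u 1 b : Fin (n + 1)) : ℕ) = ((gG n * thX n w u * ((((n + 1 - w) + (jp)) : ℕ) : ℤ) + SX2 n w u (jp)) - (gG n * thX n w u * (((n + 1 - w + (u - 1)) : ℕ) : ℤ) + SXR1 n w u)) := by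
            rw [hUr]; unfold UX; rw [show (a : ℕ) - (n + 1 - w) = jp by omega, muX_lt n (by omega), hjp]
          exact slack_of (X_u_cn_B n w u jp ((n + 1 - w)) (by omega) (by omega) (by omega) (by omega) (by omega)) hX hT1 hY
        · have hX : thX n w u * (dd n 1 : ℤ) - vv n a b 1 = (thX n w u * d1 n - conn n (((u)) - ((a : ℕ))) ((u))) := by
            rw [dd_cast_one, vv_upper_one n hab, hbu]
          have hY : UX n w u a - UX n w u ((perm n w u 1 b : Fin (n + 1)) : ℕ) = (gG n * thX n w u * (((a) : ℕ) : ℤ) - (gG n * thX n w u * (((n + 1 - w + (u - 1)) : ℕ) : ℤ) + SXR1 n w u)) := by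
            rw [hUr]; unfold UX; rw [show (a : ℕ) - (n + 1 - w) = 0 by omega, muX_zero n hu2]; simp
          exact slack_of (X_u_cn_P n w u a (by omega) (by omega) (by omega) (by omega)) hX hT1 hY
  -- between the diagonal (included) and the row `R₁` (excluded): future levels `w + 1 + k`, class 1 best; or the diagonal class-0 cell
  obtain ⟨k, hk⟩ : ∃ k, (a : ℕ) + k = n + 1 - w + u - 1 := ⟨n + 1 - w + u - 1 - (a : ℕ), by omega⟩
  have hk1 : 1 ≤ k := by omega
  have hkle : k ≤ n - w := by omega
  rcases Nat.eq_or_lt_of_le hba with hab | hab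
  · -- diagonal (`k = n − w`)
    have hab' : (a : ℕ) = (b : ℕ) := hab.symm
    have hkq : n = k + w := by omega
    by_cases hcl : l = 0
    · subst hcl
      have hX0 : thX n w u * (dd n 0 : ℤ) - vv n a b 0 = thX n w u * 0 - 0 := by rw [dd_cast_zero, vv_diag_zero n hab']
      rcases Nat.lt_or_ge (n + 1 - w) (b : ℕ) with hblk | hpl
      · obtain ⟨jp, hjp⟩ : ∃ jp, (b : ℕ) = (n + 1 - w) + jp := ⟨(b : ℕ) - (n + 1 - w), by omega⟩
        have hu : u = (n + 1 - w) + jp := by omega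
        subst hu
        have hY : UX n w ((n + 1 - w) + jp) a - UX n w ((n + 1 - w) + jp) ((perm n w ((n + 1 - w) + jp) 1 b : Fin (n + 1)) : ℕ) =
            ((gG n * thX n w ((n + 1 - w) + jp) * ((((n + 1 - w) + (jp)) : ℕ) : ℤ) + SX2 n w ((n + 1 - w) + jp) (jp)) -
              (gG n * thX n w ((n + 1 - w) + jp) * (((n + 1 - w + (((n + 1 - w) + jp) - 1)) : ℕ) : ℤ) + SXR1 n w ((n + 1 - w) + jp))) := by
          rw [hUr, hab', hjp]; unfold UX; rw [show n + 1 - w + jp - (n + 1 - w) = jp by omega, muX_lt n (by omega)]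
        exact slack_of (X_u_dg0_B n w jp ((n + 1 - w)) (by omega) (by omega) (by omega) (by omega)) hX0 hT1 hY
      · have hY : UX n w u a - UX n w u ((perm n w u 1 b : Fin (n + 1)) : ℕ) = (gG n * thX n w u * (((u) : ℕ) : ℤ) - (gG n * thX n w u * (((n + 1 - w + (u - 1)) : ℕ) : ℤ) + SXR1 n w u)) := by
          rw [hUr, hab', hbu]; unfold UX; rw [show (u) - (n + 1 - w) = 0 by omega, muX_zero n hu2]; ring
        exact slack_of (X_u_dg0_P n w u hu2 (by omega) (by omega)) hX0 hT1 hY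
    · have hθ : thX n w u ≤ LL n * ((n : ℤ) + 1) := thX_le_top n huw hwn
      have hX1 : thX n w u * (dd n 1 : ℤ) - vv n a b 1 = thX n w u * d1 n - v1 n (n + 1) (u) := by
        rw [dd_cast_one, vv_diag n hab' 1 (by decide), vblk_one, hbu]
      have hXl : thX n w u * (dd n l : ℤ) - vv n a b l + 1 ≤ thX n w u * d1 n - v1 n (n + 1) (u) + 1 ∨ l = 1 := by
        rcases (show l = 0 ∨ l = 1 ∨ l = 2 ∨ l = 3 by fin_cases l <;> simp) with rfl | rfl | rfl | rfl
        · exact absurd rfl hcl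
        · exact Or.inr rfl
        · left; rw [dd_cast_two, vv_diag n hab' 2 (by decide), vblk_two, hbu]
          linarith [lift_fut2_top n (θ := thX n w u) (u) hθ]
        · left; rw [dd_cast_three, vv_diag n hab' 3 (by decide), vblk_three, hbu]
          linarith [lift_fut3_top n (θ := thX n w u) (u) hθ]
      have hXl : thX n w u * (dd n l : ℤ) - vv n a b l ≤ thX n w u * d1 n - v1 n (n + 1) (u) := by
        rcases hXl with h | rfl
        · linarith
        · exact le_of_eq hX1
      clear hX1
      rcases Nat.lt_or_ge u (k + 1) with hku | hku
      · -- pre-block diagonal row (`u ≤ k`)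
        have hY : UX n w u a - UX n w u ((perm n w u 1 b : Fin (n + 1)) : ℕ) = (gG n * thX n w u * (((n + 1 - w + u - 1 - k) : ℕ) : ℤ) - (gG n * thX n w u * (((n + 1 - w + (u - 1)) : ℕ) : ℤ) + SXR1 n w u)) := by
          rw [hUr]; unfold UX; rw [show (a : ℕ) - (n + 1 - w) = 0 by omega, muX_zero n hu2, show (a : ℕ) = n + 1 - w + u - 1 - k by omega]; ring
        exact slack_le (X_u_up_P_m n w u k hu2 (by omega) (by omega) hkq) hXl hT1 hY
      · have hY : UX n w u a - UX n w u ((perm n w u 1 b : Fin (n + 1)) : ℕ) = ((gG n * thX n w u * (((n + 1 - w + (u - 1 - k)) : ℕ) : ℤ) + SX2 n w u (u - 1 - k)) - (gG n * thX n w u * (((n + 1 - w + (u - 1)) : ℕ) : ℤ) + SXR1 n w u)) := by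
          rw [hUr]; unfold UX; rw [show (a : ℕ) - (n + 1 - w) = u - 1 - k by omega, muX_lt n (by omega), show (a : ℕ) = n + 1 - w + (u - 1 - k) by omega]
        exact slack_le (X_u_up_A_m n w u k (by omega) (by omega) (by omega) hkq) hXl hT1 hY
  · -- strictly between: level `w + 1 + k ≤ n`
    have hlow : (b : ℕ) < (a : ℕ) := hab
    have hEa : n + 1 + (b : ℕ) - (a : ℕ) = w + 1 + k := by omega
    have hne1 : w + 1 + k ≠ n + 1 := by omega
    have hkn : k + (w + 1) ≤ n := by omega
    have hθ : thX n w u ≤ LL n * ((w + 1 + k : ℕ) : ℤ) := thX_le_LE n huw hwn (by omega)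
    have hcl : l ≠ 0 := fun h0 => by subst h0; exact hp (ee_lower_zero n hlow)
    have hX1 : thX n w u * (dd n 1 : ℤ) - vv n a b 1 = thX n w u * d1 n - v1 n (w + 1 + k) (u) := by
      rw [dd_cast_one, vv_lower n hlow, hEa, vblk_one, hbu]
    have hXl : thX n w u * (dd n l : ℤ) - vv n a b l + 1 ≤ thX n w u * d1 n - v1 n (w + 1 + k) (u) + 1 ∨ l = 1 := by
      rcases (show l = 0 ∨ l = 1 ∨ l = 2 ∨ l = 3 by fin_cases l <;> simp) with rfl | rfl | rfl | rfl
      · exact absurd rfl hcl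
      · exact Or.inr rfl
      · left; rw [dd_cast_two, vv_lower n hlow, hEa, vblk_two, tau2_of_ne n hne1, hbu]
        linarith [lift_fut2 n (θ := thX n w u) (E := w + 1 + k) (u) hθ]
      · left; rw [dd_cast_three, vv_lower n hlow, hEa, vblk_three, tau2_of_ne n hne1, tau3_of_ne n hne1, hbu]
        linarith [lift_fut3 n (θ := thX n w u) (E := w + 1 + k) (u) hθ]
    have hXl : thX n w u * (dd n l : ℤ) - vv n a b l ≤ thX n w u * d1 n - v1 n (w + 1 + k) (u) := by
      rcases hXl with h | rfl
      · linarith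
      · exact le_of_eq hX1
    clear hX1 hEa hne1 hθ
    rcases Nat.lt_or_ge u (k + 1) with hku | hku
    · have hY : UX n w u a - UX n w u ((perm n w u 1 b : Fin (n + 1)) : ℕ) = (gG n * thX n w u * (((n + 1 - w + u - 1 - k) : ℕ) : ℤ) - (gG n * thX n w u * (((n + 1 - w + (u - 1)) : ℕ) : ℤ) + SXR1 n w u)) := by
        rw [hUr]; unfold UX; rw [show (a : ℕ) - (n + 1 - w) = 0 by omega, muX_zero n hu2, show (a : ℕ) = n + 1 - w + u - 1 - k by omega]; ring
      exact slack_le (X_u_up_P_lt n w u k hu2 (by omega) (by omega) hkn) hXl hT1 hY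
    · have hY : UX n w u a - UX n w u ((perm n w u 1 b : Fin (n + 1)) : ℕ) = ((gG n * thX n w u * (((n + 1 - w + (u - 1 - k)) : ℕ) : ℤ) + SX2 n w u (u - 1 - k)) - (gG n * thX n w u * (((n + 1 - w + (u - 1)) : ℕ) : ℤ) + SXR1 n w u)) := by
        rw [hUr]; unfold UX; rw [show (a : ℕ) - (n + 1 - w) = u - 1 - k by omega, muX_lt n (by omega), show (a : ℕ) = n + 1 - w + (u - 1 - k) by omega]
      exact slack_le (X_u_up_A_lt n w u k (by omega) (by omega) (by omega) hkn) hXl hT1 hY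

set_option maxHeartbeats 400000 in
/-- slack of the type-X certificate: the lifted block column `b = u`, rival rows at or below the intended row `R₁`. -/
theorem slackX_u_lo (w u : ℕ) (hu2 : 2 ≤ u) (huw : u < w) (hwn : w ≤ n) (a b : Fin (n + 1)) (l : Fin 4)
    (hp : ee n a b l ≠ 0) (hne : perm n w u 1 b ≠ a ∨ lam n w u 1 b ≠ l) (hbu : (b : ℕ) = u) (haR : n + 1 - w + u - 1 ≤ (a : ℕ)) :
    1 * (thX n w u * (dd n l : ℤ) - vv n a b l) <
      UX n w u a + ((thX n w u * (dd n (lam n w u 1 b) : ℤ) - vv n (perm n w u 1 b) b (lam n w u 1 b)) - UX n w u (perm n w u 1 b)) := by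
  have hw1 : w ≤ n + 1 := by omega
  have han : (a : ℕ) ≤ n := Nat.lt_succ_iff.mp a.isLt
  have hr : ((perm n w u 1 b : Fin (n + 1)) : ℕ) = n + 1 - w + u - 1 := sigmaX_u n huw hwn b hbu
  rw [lam_X n huw] at hne ⊢
  rw [if_neg (show ¬ w ≤ (b : ℕ) by omega), if_neg (show ¬ ((b : ℕ) + 1 < u) by omega),
    if_neg (show ¬ ((b : ℕ) < u) by omega)] at hne ⊢
  have hT1 : thX n w u * (dd n 1 : ℤ) - vv n (perm n w u 1 b) b 1 = thX n w u * d1 n - v1 n (w + 1) (u) := by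
    rcases Nat.lt_or_ge w n with hwn' | hwn'
    · have hlowr : (b : ℕ) < ((perm n w u 1 b : Fin (n + 1)) : ℕ) := by rw [hr]; omega
      rw [dd_cast_one, vv_lower n hlowr, hr, show n + 1 + (b : ℕ) - (n + 1 - w + u - 1) = w + 1 by omega, vblk_one, hbu]
    · have hdg : (((perm n w u 1 b : Fin (n + 1)) : ℕ)) = (b : ℕ) := by rw [hr]; omega
      rw [dd_cast_one, vv_diag n hdg 1 (by decide), vblk_one, hbu, show n + 1 = w + 1 by omega]
  have hUr : UX n w u ((perm n w u 1 b : Fin (n + 1)) : ℕ) = gG n * thX n w u * (((n + 1 - w + (u - 1)) : ℕ) : ℤ) + SXR1 n w u := by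
    rw [hr]; unfold UX; rw [show n + 1 - w + u - 1 - (n + 1 - w) = u - 1 by omega, muX_R1 n (show u - 1 + 1 = u by omega),
      show n + 1 - w + u - 1 = n + 1 - w + (u - 1) by omega]
  rcases Nat.eq_or_lt_of_le haR with haR1 | hagt
  · -- the intended cell `R₁`
    have hrot : perm n w u 1 b = a := Fin.ext (by rw [hr, haR1])
    have hY : UX n w u a - UX n w u ((perm n w u 1 b : Fin (n + 1)) : ℕ) = 0 := by rw [hrot]; ring
    rcases Nat.lt_or_ge w n with hwn' | hwn'
    · -- a lower cell (`w < n`): level `w + 1`, class 1 best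
      have hlow : (b : ℕ) < (a : ℕ) := by omega
      have hEa : n + 1 + (b : ℕ) - (a : ℕ) = w + 1 := by omega
      have hne1 : w + 1 ≠ n + 1 := by omega
      have hθ : thX n w u ≤ LL n * ((w + 1 : ℕ) : ℤ) := thX_le_LE n huw hwn (le_refl _)
      rcases (show l = 0 ∨ l = 1 ∨ l = 2 ∨ l = 3 by fin_cases l <;> simp) with rfl | rfl | rfl | rfl
      · exact absurd (ee_lower_zero n hlow) hp
      · exact absurd rfl (hne.resolve_left (fun h => h hrot))
      · have hX : thX n w u * (dd n 2 : ℤ) - vv n a b 2 = thX n w u * d2 n - (v1 n (w + 1) (u) + bB n * tau2lt n (w + 1) (u)) := by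
          rw [dd_cast_two, vv_lower n hlow, hEa, vblk_two, tau2_of_ne n hne1, hbu]
        exact slack_of0 (lift_fut2 n (θ := thX n w u) (E := w + 1) (u) hθ) hX hT1 hY
      · have hX : thX n w u * (dd n 3 : ℤ) - vv n a b 3 = thX n w u * d3 n - (v1 n (w + 1) (u) + bB n * tau2lt n (w + 1) (u) + tau3lt n (w + 1) (u)) := by
          rw [dd_cast_three, vv_lower n hlow, hEa, vblk_three, tau2_of_ne n hne1, tau3_of_ne n hne1, hbu]
        exact slack_of0 (lift_fut3 n (θ := thX n w u) (E := w + 1) (u) hθ) hX hT1 hY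
    · -- the diagonal (`w = n`): the top level
      have hab' : (a : ℕ) = (b : ℕ) := by omega
      have hwn2 : n = w := by omega
      have hθ : thX n w u ≤ LL n * ((n : ℤ) + 1) := thX_le_top n huw hwn
      rcases (show l = 0 ∨ l = 1 ∨ l = 2 ∨ l = 3 by fin_cases l <;> simp) with rfl | rfl | rfl | rfl
      · have hX0 : thX n w u * (dd n 0 : ℤ) - vv n a b 0 = thX n w u * 0 - 0 := by rw [dd_cast_zero, vv_diag_zero n hab']
        obtain ⟨jp, hjp⟩ : ∃ jp, u = jp + 1 := ⟨u - 1, by omega⟩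
        subst hjp
        exact slack_of (X_u_dg0_at n w jp (by omega) (by omega) hwn2) hX0 hT1 hY
      · exact absurd rfl (hne.resolve_left (fun h => h hrot))
      · have hX : thX n w u * (dd n 2 : ℤ) - vv n a b 2 = thX n w u * d2 n - (v1 n (n + 1) (u) + bB n * tau2 n (n + 1) (u)) := by
          rw [dd_cast_two, vv_diag n hab' 2 (by decide), vblk_two, hbu]
        have hF := lift_fut2_top n (θ := thX n w u) (u) hθ
        rw [show n + 1 = w + 1 by omega] at hF hX
        exact slack_of0 hF hX hT1 hY
      · have hX : thX n w u * (dd n 3 : ℤ) - vv n a b 3 = thX n w u * d3 n - (v1 n (n + 1) (u) + bB n * tau2 n (n + 1) (u) + tau3 n (n + 1) (u)) := by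
          rw [dd_cast_three, vv_diag n hab' 3 (by decide), vblk_three, hbu]
        have hF := lift_fut3_top n (θ := thX n w u) (u) hθ
        rw [show n + 1 = w + 1 by omega] at hF hX
        exact slack_of0 hF hX hT1 hY
  · -- below the intended cell
    have hlow : (b : ℕ) < (a : ℕ) := by omega
    have hcl : l ≠ 0 := fun h0 => by subst h0; exact hp (ee_lower_zero n hlow)
    rcases Nat.eq_or_lt_of_le (show n + 1 - w + u ≤ (a : ℕ) by omega) with haR2 | hagt2
    · -- the row `R₂` (level `w`)
      have hEa : n + 1 + (b : ℕ) - (a : ℕ) = w := by omega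
      have hwne : w ≠ n + 1 := by omega
      have hY : UX n w u a - UX n w u ((perm n w u 1 b : Fin (n + 1)) : ℕ) = ((gG n * thX n w u * (((n + 1 - w + (u)) : ℕ) : ℤ) + SXR2 n w u) - (gG n * thX n w u * (((n + 1 - w + (u - 1)) : ℕ) : ℤ) + SXR1 n w u)) := by
        rw [hUr]; unfold UX; rw [show (a : ℕ) - (n + 1 - w) = u by omega, muX_R2, ← haR2]
      rcases (show l = 0 ∨ l = 1 ∨ l = 2 ∨ l = 3 by fin_cases l <;> simp) with rfl | rfl | rfl | rfl
      · exact absurd rfl hcl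
      · have hX : thX n w u * (dd n 1 : ℤ) - vv n a b 1 = thX n w u * d1 n - v1 n (w) (u) := by
          rw [dd_cast_one, vv_lower n hlow, hEa, vblk_one, hbu]
        exact slack_of (X_u_R2_l1 n w u hu2 (by omega) hwn) hX hT1 hY
      · have hX : thX n w u * (dd n 2 : ℤ) - vv n a b 2 = thX n w u * d2 n - (v1 n (w) (u) + bB n * tau2lt n (w) (u)) := by
          rw [dd_cast_two, vv_lower n hlow, hEa, vblk_two, tau2_of_ne n hwne, hbu]
        exact slack_of (X_u_R2_l2 n w u hu2 (by omega) hwn) hX hT1 hY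
      · have hX : thX n w u * (dd n 3 : ℤ) - vv n a b 3 = thX n w u * d3 n - ((v1 n (w) (u) + bB n * tau2lt n (w) (u)) + tau3lt n (w) (u)) := by
          rw [dd_cast_three, vv_lower n hlow, hEa, vblk_three, tau2_of_ne n hwne, tau3_of_ne n hwne, hbu]
        exact slack_of (X_u_R2_l3 n w u hu2 (by omega) hwn) hX hT1 hY
    · -- past levels `w − k`, class 3 best
      obtain ⟨k, hk⟩ : ∃ k, (a : ℕ) = (n + 1 - w + u) + k := ⟨(a : ℕ) - (n + 1 - w + u), by omega⟩
      have hu1 : 1 ≤ u := by clear hT1 hUr hr; omega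
      have hk1 : 1 ≤ k := by clear hT1 hUr hr; omega
      have hkw : (k + u) + 1 ≤ w := by clear hT1 hUr hr; omega
      have hEa : n + 1 + (b : ℕ) - (a : ℕ) = w - k := by clear hT1 hUr hr; omega
      have hne3 : w - k ≠ n + 1 := by clear hT1 hUr hr hEa; omega
      have hcn : u ≤ n := by clear hT1 hUr hr hEa hne3; omega
      have hEn : w - k ≤ n := by clear hT1 hUr hr hEa hne3; omega
      have hj : (a : ℕ) - (n + 1 - w) = u + k := by clear hT1 hUr hr hEa hne3 hcn hEn; omega
      have hθ : LL n * ((w - k : ℕ) + 1) ≤ thX n w u :=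
        LE_le_thX n u (by clear hT1 hUr hr hEa hne3 hcn hEn hj; omega)
      have hX3 : thX n w u * (dd n 3 : ℤ) - vv n a b 3 = thX n w u * d3 n - ((v1 n (w - k) (u) + bB n * tau2lt n (w - k) (u)) + tau3lt n (w - k) (u)) := by
        rw [dd_cast_three, vv_lower n hlow, hEa, vblk_three, tau2_of_ne n hne3, tau3_of_ne n hne3, hbu]
      have hlift : thX n w u * (dd n l : ℤ) - vv n a b l + (if l = 3 then 0 else 1) ≤ thX n w u * d3 n - ((v1 n (w - k) (u) + bB n * tau2lt n (w - k) (u)) + tau3lt n (w - k) (u)) := by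
        rcases (show l = 0 ∨ l = 1 ∨ l = 2 ∨ l = 3 by fin_cases l <;> simp) with rfl | rfl | rfl | rfl
        · exact absurd rfl hcl
        · rw [dd_cast_one, vv_lower n hlow, hEa, vblk_one, hbu]
          simp only [show ((1 : Fin 4) = 3) = False by decide, ite_false]
          linarith [lift_past1 n (θ := thX n w u) (c := u) (E := w - k) hcn hEn hθ]
        · rw [dd_cast_two, vv_lower n hlow, hEa, vblk_two, tau2_of_ne n hne3, hbu]
          simp only [show ((2 : Fin 4) = 3) = False by decide, ite_false]
          linarith [lift_past2 n (θ := thX n w u) (c := u) (E := w - k) hcn hEn hθ]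
        · rw [hX3]; simp
      clear hX3 hEa hne3 hcn hEn hθ
      rcases Nat.lt_or_ge k 2 with hk2 | hk2
      · -- `k = 1`: the row `u + 1`
        have hkone : k = 1 := by clear hT1 hUr hlift hr hj; omega
        subst hkone
        have hY : UX n w u a - UX n w u ((perm n w u 1 b : Fin (n + 1)) : ℕ) = (gG n * thX n w u * ((2 : ℕ) : ℤ) + (SXP n w u - SXR1 n w u)) := by
          rw [hUr]; unfold UX; rw [hj, muX_P, hk]; push_cast [Nat.cast_sub hw1, Nat.cast_sub hu1]; ring
        have hF := X_u_down_P n w u hu2 (by clear hT1 hUr hlift hr hj hY; omega) hwn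
        exact slack_of (lift_combine hlift hF) rfl hT1 hY
      · have huk : u + 2 ≤ u + k := by clear hT1 hUr hlift hr hj; omega
        have hY : UX n w u a - UX n w u ((perm n w u 1 b : Fin (n + 1)) : ℕ) = (gG n * thX n w u * ((k + 1 : ℕ) : ℤ) + (SXL n w u (u + k) - SXR1 n w u)) := by
          rw [hUr]; unfold UX; rw [hj, muX_ge n huk, hk]; push_cast [Nat.cast_sub hw1, Nat.cast_sub hu1]; ring
        have hF := X_u_down_ge n w u k hu2 hk2 hkw hwn
        exact slack_of (lift_combine hlift hF) rfl hT1 hY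

/-- slack of the type-X certificate: the lifted block column `b = u`. -/
theorem slackX_u (w u : ℕ) (hu2 : 2 ≤ u) (huw : u < w) (hwn : w ≤ n) (a b : Fin (n + 1)) (l : Fin 4)
    (hp : ee n a b l ≠ 0) (hne : perm n w u 1 b ≠ a ∨ lam n w u 1 b ≠ l) (hbu : (b : ℕ) = u) :
    1 * (thX n w u * (dd n l : ℤ) - vv n a b l) <
      UX n w u a + ((thX n w u * (dd n (lam n w u 1 b) : ℤ) - vv n (perm n w u 1 b) b (lam n w u 1 b)) - UX n w u (perm n w u 1 b)) := by
  rcases Nat.lt_or_ge (a : ℕ) (n + 1 - w + u - 1) with h | h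
  · exact slackX_u_hi n w u hu2 huw hwn a b l hp hbu h
  · exact slackX_u_lo n w u hu2 huw hwn a b l hp hne hbu h

end GradedWalk

end Summit.ValiantsHypothesis.ValiantsHypothesis.Theorems.LacunarySymmetroidMatrixDescartes.TropicalCensus
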